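import Summits.QuantumAdvantage.AdviceFreeQNC0.AffBells28SubFibre
import HarnessLib

/-!
# L-36 part F, typed: BALANCED ⇒ PARITY = SIZE ⇒ a class-pure strategy wins iff `pairs2` is even (qn-lit g29; sketch, ns `AffBells29lit`)

If at the odd input `x` the ACTIVE rows of an affine-bell strategy `(β, c)` are labelled into groups (`cls`), each row `h` fires iff a
row-level value `a h` equals a group-level value `φ (cls h)` (so the coins enter only through the `φ`'s), and inside every group the three
value classes `{a = 0}, {a = 1}, {a = 2}` have cardinalities of equal parity ("balanced"), then the number of firing active rows has the
parity of the number of active rows (`activeOnes_mod_two_of_balanced`), and by `TargetFormula` the ring relation holds iff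
`pairs2 (kline x)` is even (`rel_iff_pairs2_even`) — whatever `β`, `c`, `φ`.  This is the mechanism behind the WINDOW-PURE far-from-frame
strategies RT⋆ of LIT-MEMO-38 §3.4 (every run of the strategy is one balanced group): no cube witness anywhere, win rate `P[pairs2 even] ≈ ½`.
PROVED, no hypotheses on `β`.
-/

namespace Summit.QuantumAdvantage.AdviceFreeQNC0

namespace AffBells29lit

open Finset Literature.Computability.QuantumComplexity Literature.Computability.QuantumComplexity.RingHLF
open AffBells23 AffBells26 Fib19 AffBells27 AffBells28

variable {N : ℕ}

/-- Counting mod 2 inside one balanced group: if the three value classes have equal parities, the class of any value `e` has the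
parity of the whole group. -/
theorem card_filter_eq_mod_two_of_balanced {α : Type*} [DecidableEq α] (G : Finset α) (a : α → ZMod 3)
    (hbal : ∀ e e' : ZMod 3, (G.filter fun h => a h = e).card % 2 = (G.filter fun h => a h = e').card % 2) (e : ZMod 3) :
    (G.filter fun h => a h = e).card % 2 = G.card % 2 := by
  have hsplit : G.card = ∑ v : ZMod 3, (G.filter fun h => a h = v).card := by
    rw [← card_eq_sum_card_fiberwise (f := a) (s := G) (t := univ) (fun _ _ => mem_univ _)]
  rw [hsplit, Finset.sum_nat_mod, Finset.sum_congr rfl (fun v _ => hbal v e), sum_const, card_univ, ZMod.card,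
    smul_eq_mul]
  omega

/-- **BALANCED ⇒ PARITY = SIZE.**  Active rows labelled into groups `cls h`, firing pattern `affBell β c x h = true ↔ a h = φ (cls h)`,
every group balanced ⇒ `activeOnes ≡ #act (mod 2)`. -/
theorem activeOnes_mod_two_of_balanced {ι : Type*} [DecidableEq ι] (β : Fin N → Fin N → ZMod 3) (c : Fin N → ZMod 3)
    (x : Fin N → Bool) (cls : Fin N → ι) (a : Fin N → ZMod 3) (φ : ι → ZMod 3)
    (hfire : ∀ h ∈ act x, (affBell β c x h = true ↔ a h = φ (cls h)))
    (hbal : ∀ i : ι, ∀ e e' : ZMod 3,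
      (((act x).filter fun h => cls h = i).filter fun h => a h = e).card % 2 =
        (((act x).filter fun h => cls h = i).filter fun h => a h = e').card % 2) :
    activeOnes x (affBell β c x) % 2 = (act x).card % 2 := by
  classical
  -- `activeOnes` as a filter of `act x`
  have hA : activeOnes x (affBell β c x) = ((act x).filter fun h => affBell β c x h = true).card := by
    unfold activeOnes act
    rw [filter_filter]
  rw [hA]
  -- fibrewise over the groups present
  set T := (act x).image cls with hT
  have hmaps : ∀ h ∈ act x, cls h ∈ T := fun h hh => mem_image_of_mem cls hh
  have hfib₁ := card_eq_sum_card_fiberwise (f := cls) (s := (act x).filter fun h => affBell β c x h = true) (t := T)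
    (fun h hh => hmaps h (mem_filter.1 hh).1)
  have hfib₂ := card_eq_sum_card_fiberwise (f := cls) (s := act x) (t := T) hmaps
  rw [hfib₁, hfib₂, Finset.sum_nat_mod, Finset.sum_nat_mod (s := T) (f := fun i => ((act x).filter fun h => cls h = i).card)]
  congr 1
  refine sum_congr rfl fun i _ => ?_
  -- inside group i: firing rows = rows with a h = φ i
  have hgrp : ((act x).filter fun h => affBell β c x h = true).filter (fun h => cls h = i) =
      ((act x).filter fun h => cls h = i).filter fun h => a h = φ i := by
    ext h
    simp only [mem_filter]
    constructor
    · rintro ⟨⟨hh, hf⟩, hc⟩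
      exact ⟨⟨hh, hc⟩, by rw [← hc]; exact (hfire h hh).1 hf⟩
    · rintro ⟨⟨hh, hc⟩, ha⟩
      exact ⟨⟨hh, (hfire h hh).2 (by rw [hc]; exact ha)⟩, hc⟩
  rw [hgrp]
  exact card_filter_eq_mod_two_of_balanced _ a (hbal i) (φ i)

/-- `#act + #zeros = N`. -/
theorem card_act_add_zeros (x : Fin N → Bool) : (act x).card + zeros (kline x) = N := by
  unfold act zeros
  have hneg : (univ.filter fun g : Fin N => ¬ kline x g = true) = univ.filter fun i : Fin N => kline x i = false := by
    simp only [Bool.not_eq_true]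
  rw [← hneg, Finset.card_filter_add_card_filter_not, card_univ, Fintype.card_fin]

/-- **CLASS-PURE ⇒ (WIN ⟺ `pairs2` EVEN) (PROVED).**  Under the hypotheses of `activeOnes_mod_two_of_balanced` at an odd `x` (`N ≥ 3`),
the ring relation holds iff `pairs2 (kline x)` is even — independently of `β`, `c` and the group values `φ`. -/
theorem rel_iff_pairs2_even {ι : Type*} [DecidableEq ι] (hN : 3 ≤ N) (β : Fin N → Fin N → ZMod 3) (c : Fin N → ZMod 3)
    {x : Fin N → Bool} (hx : IsOdd x) (cls : Fin N → ι) (a : Fin N → ZMod 3) (φ : ι → ZMod 3)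
    (hfire : ∀ h ∈ act x, (affBell β c x h = true ↔ a h = φ (cls h)))
    (hbal : ∀ i : ι, ∀ e e' : ZMod 3,
      (((act x).filter fun h => cls h = i).filter fun h => a h = e).card % 2 =
        (((act x).filter fun h => cls h = i).filter fun h => a h = e').card % 2) :
    RingHLF.Rel x (affBell β c x) ↔ pairs2 (kline x) % 2 = 0 := by
  rw [targetFormula N hN x hx (affBell β c x)]
  have h1 := activeOnes_mod_two_of_balanced β c x cls a φ hfire hbal
  have h2 := card_act_add_zeros x
  omega

end AffBells29lit

end Summit.QuantumAdvantage.AdviceFreeQNC0
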